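import Mathlib
import HarnessLib
import Literature.AlgebraicGeometry.Resolution.ResolutionOfSingularities
import Summits.ResolutionOfSingularities.ResolutionOfSingularities.Theorems.RadicandHessianClasses
import Summits.ResolutionOfSingularities.ResolutionOfSingularities.Theorems.WeakOrderReduction

/-!
# RadicandSplitCorank — the split-corank grading of purely inseparable radicands (decomp-res node
«CorankLadder», lens-1 g7), route-independent part

Source HOME/decomp-res-lens-1/g7/CorankLadder.lean (sha256 6d558789858ead62, 393 lines; critic `lean check` rc 0, 0
err, 0 warn, 0 sorry, `root_of` axioms standard), CRITIC-LEDGER row 48 (2026-08-30T07:33Z): CLEARED AS MAP NODE,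
child of the portfolio blocker `PAlteration.PicoverLocalModel` (item 0557) (residual 0 · decision 0 · map +1).  This
file carries the ROUTE-INDEPENDENT vocabulary verbatim (§Pointwise, §Pieces of the source; imports: Literature + the
landed `Theorems.RadicandHessianClasses` (for `NonCriticalAt` BY NAME) and `Theorems.WeakOrderReduction` (for
`WeakResolution` / `CentreSeq` / `MarkedIdeal` BY NAME) only):
* pointwise classes of `x ∈ O` (`O` local) modulo `p`-th powers: `IsSplitRsop`, `SplitAt p h s c` (a SPLIT
  PRESENTATION: `h` hyperbolic pairs, `s` unit squares (odd `p` only), a tail of length `c`), `SplitCorankLE p c`,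
  `MonomialAtN p` (Kummer point, any embedding dimension), the cumulative MENU `GoodLE p c` (non-critical ∨ monomial
  ∨ split corank ≤ c) with `splitCorankLE_mono`, `goodLE_mono`;
* the graded pieces of the blocker, PARAMETRISED: `LocalModelRes p R a` (= 0557's conclusion verbatim), `AllGoodLE p
  c R a`, `PicoverLocalModelCorankLE c`, `PicoverLocalModelCorankGT c`, and the typed attack leaf
  `WeakMarkedRadicand d` (weak resolution of the marked ideal `((Tᵖ − g), 2)` on `Spec S[T]`, `S` regular of
  dimension `≤ d`, over lens-2's landed `WeakOrderReduction.WeakResolution`);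
* the cumulativity kernels `corankLE_mono`, `corankGT_mono` (PROVED).
The EXACT decomposition `PicoverLocalModel ⟺ CorankLE c ∧ CorankGT c` (every `c`), `closes` to 0557 and `root_of` to
ROOT BY NAME live in `Theorems.PicoverLocalModelCorankLadder` (they import route files).  Known range
(Cossart–Jannsen–Saito 2020 Thm. 1.4; Benito–Villamayor 2012; Kato 1994): `c ≤ 2` for every `n = dim R` and every
`p`; first open rung `c = 3` = ONE embedded statement in ambient dimension 4 (`WeakMarkedRadicand 3`;
valuation-local form Cossart–Piltant 2008/2009).  No statement here is a claim: definitions + proved monotonicity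
only; no instances, no notation.
-/

namespace Summit.ResolutionOfSingularities.ResolutionOfSingularities.Theorems.RadicandSplitCorank

open AlgebraicGeometry Literature.AlgebraicGeometry.Resolution
open Summit.ResolutionOfSingularities.ResolutionOfSingularities.Theorems
open Summit.ResolutionOfSingularities.ResolutionOfSingularities.Theorems.RadicandHessianClasses

/-! ## Pointwise classes of `x ∈ O` (`O` local; in use `O = R_𝔪`), modulo `p`-th powers -/

section Pointwise

variable {O : Type} [CommRing O] [IsLocalRing O]

/-- `(u, u', v, w)` — `h` hyperbolic pairs, `s` square directions, a tail of length `c` — is a regular system of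
parameters of `O`: the blocks generate `𝔪` and `𝔪` needs exactly `2h + s + c` generators (so the family is injective
and minimal). -/
def IsSplitRsop (h s c : ℕ) (u u' : Fin h → O) (v : Fin s → O) (w : Fin c → O) : Prop :=
  Ideal.span (Set.range u ∪ Set.range u' ∪ Set.range v ∪ Set.range w) = IsLocalRing.maximalIdeal O ∧
    (IsLocalRing.maximalIdeal O).spanFinrank = 2 * h + s + c

/-- SPLIT PRESENTATION of type `(h, s, c)` of the class of `x` modulo `p`-th powers: for some shift `t`,
`x − tᵖ ≡ Σ_{i<h} uᵢ·uᵢ' + Σ_{j<s} εⱼ·vⱼ²  (mod (w)² + 𝔪³)` in a regular system of parameters `(u,u',v,w)`, the `εⱼ`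
units, and unit squares are booked only for odd `p` (for `p = 2` the diagonal of the quadratic part is not an
invariant of the class).  The tail `w` carries an ARBITRARY quadratic part: the type records how much has been split
off, so `c` is an upper bound («split corank ≤ c»).  (Port P1 of the node = formal Morse splitting modulo
Frobenius.) -/
def SplitAt (p h s c : ℕ) (x : O) : Prop :=
  ∃ (t : O) (u u' : Fin h → O) (v e : Fin s → O) (w : Fin c → O),
    IsSplitRsop h s c u u' v w ∧ (∀ j, e j ∉ IsLocalRing.maximalIdeal O) ∧ (s = 0 ∨ p ≠ 2) ∧
      x - t ^ p - (∑ i, u i * u' i) - (∑ j, e j * v j ^ 2) ∈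
        Ideal.span (Set.range w) ^ 2 ⊔ IsLocalRing.maximalIdeal O ^ 3

/-- SPLIT CORANK `≤ c`: some split presentation has tail length `≤ c`. -/
def SplitCorankLE (p c : ℕ) (x : O) : Prop :=
  ∃ h s c', c' ≤ c ∧ SplitAt p h s c' x

/-- PURE MONOMIAL (Kummer) point, any embedding dimension: a shift of `x` is a monomial in a regular system of
parameters (the all-dimension form of `RadicandHessianClasses`' monomial points; such local models are log regular,
Kato 1994). -/
def MonomialAtN (p : ℕ) (x : O) : Prop :=
  ∃ (t : O) (n : ℕ) (y : Fin n → O) (m : Fin n → ℕ),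
    Ideal.span (Set.range y) = IsLocalRing.maximalIdeal O ∧ (IsLocalRing.maximalIdeal O).spanFinrank = n ∧
      x - t ^ p = ∏ i, y i ^ m i

/-- The cumulative MENU of grade `c`: non-critical (`RadicandHessianClasses.NonCriticalAt`, BY NAME) or pure monomial
or split corank `≤ c`. -/
def GoodLE (p c : ℕ) (x : O) : Prop :=
  NonCriticalAt p x ∨ MonomialAtN p x ∨ SplitCorankLE p c x

/-- Split corank is cumulative in `c`. [folklore] -/
theorem splitCorankLE_mono {p c c' : ℕ} (hcc' : c ≤ c') {x : O} (hx : SplitCorankLE p c x) :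
    SplitCorankLE p c' x := by
  obtain ⟨h, s, c₀, hc₀, hsplit⟩ := hx
  exact ⟨h, s, c₀, hc₀.trans hcc', hsplit⟩

/-- The menu is cumulative in `c`. [folklore] -/
theorem goodLE_mono {p c c' : ℕ} (hcc' : c ≤ c') {x : O} (hx : GoodLE p c x) : GoodLE p c' x := by
  rcases hx with hA | hB | hC
  · exact Or.inl hA
  · exact Or.inr (Or.inl hB)
  · exact Or.inr (Or.inr (splitCorankLE_mono hcc' hC))

end Pointwise

/-! ## The graded pieces of the blocker `PicoverLocalModel` (0557), parametrised -/

section Pieces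

/-- The conclusion of `PicoverLocalModel` (0557) for one radicand: the reduced local model `Spec (R[T]/(Tᵖ − a))_red`
has a resolution (verbatim the blocker's conclusion). -/
def LocalModelRes (p : ℕ) (R : Type) [CommRing R] (a : R) : Prop :=
  Scheme.HasResolution
    (Spec (.of (AdjoinRoot (Polynomial.X ^ p - Polynomial.C a) ⧸
      nilradical (AdjoinRoot (Polynomial.X ^ p - Polynomial.C a)))))

/-- Every maximal ideal of `R` is a menu point of grade `c` for `a` (read in `R_𝔪`). -/
def AllGoodLE (p c : ℕ) (R : Type) [CommRing R] (a : R) : Prop :=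
  ∀ (𝔪 : Ideal R) [𝔪.IsMaximal], GoodLE p c (algebraMap R (Localization.AtPrime 𝔪) a)

/-- GRADE `≤ c` OF THE BLOCKER: `PicoverLocalModel` restricted to radicands all of whose maximal ideals are
non-critical, pure monomial, or of split corank `≤ c`.  `c = 2`: KNOWN-MOD-PORT for every `n` and `p` (non-critical
points regular; Kummer points log regular — Kato 1994; tail `c ≤ 2` by Cossart–Jannsen–Saito 2020 Thm. 1.4 /
Benito–Villamayor 2012; ports P1 formal splitting, P2 quadric chart identity, P3 weakly admissible extraction, P4
gluing along positive-dimensional critical strata).  `c = 3`: reduces modulo P1/P2/P4 to the single dimension-PINNED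
statement `WeakMarkedRadicand 3` — the first open rung. -/
def PicoverLocalModelCorankLE (c : ℕ) : Prop :=
  ∀ p : ℕ, p.Prime → ∀ (k : Type) [Field k] [CharP k p] (R : Type) [CommRing R] [IsDomain R]
    [Algebra k R], Algebra.FiniteType k R → IsRegularRing R → ∀ a : R,
      AllGoodLE p c R a → LocalModelRes p R a

/-- RESIDUAL OF GRADE `> c`: `PicoverLocalModel` restricted to radicands with at least one maximal ideal OUTSIDE the
grade-`c` menu (COFINAL: it contains every radicand with one umbilic of split corank `> c`; declared residual, honest
score 0 — «Temkin's purely inseparable case proper»). -/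
def PicoverLocalModelCorankGT (c : ℕ) : Prop :=
  ∀ p : ℕ, p.Prime → ∀ (k : Type) [Field k] [CharP k p] (R : Type) [CommRing R] [IsDomain R]
    [Algebra k R], Algebra.FiniteType k R → IsRegularRing R → ∀ a : R,
      ¬ AllGoodLE p c R a → LocalModelRes p R a

/-- The typed ATTACK LEAF of grade `c = d`, over lens-2's landed vocabulary (`WeakOrderReduction.WeakResolution`:
weakly admissible centre sequence — regular centres inside the support of the controlled transform — with empty final
support): WEAK RESOLUTION OF THE MARKED RADICAND IDEAL `((Tᵖ − g), 2)` on `Spec S[T]` for `S` a regular finitely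
generated `k`-domain of dimension `≤ d` and `g ∈ S` — exactly what the quadric bundle over a point of split corank
`d` consumes (chart identity P2, verified by the critic).  `d ≤ 2` KNOWN-MOD-PORT (Cossart–Jannsen–Saito 2020 Thm.
1.4); `d = 3` OPEN = the test of `PicoverLocalModelCorankLE 3` (valuation-local form: Cossart–Piltant 2008/2009);
for `p = 2` literally an instance of `WeakOrderReduction.SeqDimFour 1 2`. -/
def WeakMarkedRadicand (d : ℕ) : Prop :=
  ∀ p : ℕ, p.Prime → ∀ (k : Type) [Field k] [CharP k p] (S : Type) [CommRing S] [IsDomain S]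
    [Algebra k S], Algebra.FiniteType k S → IsRegularRing S → ringKrullDim S ≤ d → ∀ g : S,
      ∃ t : CentreSeq (Spec (.of (Polynomial S))),
        WeakOrderReduction.WeakResolution t
          (⟨Scheme.IdealSheafData.ofIdealTop
              ((Ideal.span {(Polynomial.X ^ p - Polynomial.C g : Polynomial S)}).map
                (Scheme.ΓSpecIso (.of (Polynomial S))).inv.hom),
            [], 2⟩ : MarkedIdeal (Spec (.of (Polynomial S))))

end Pieces

/-! ## Route-independent kernels: cumulativity -/

section Kernels

/-- Cumulativity: a smaller grade is a special case of a larger one. [folklore] -/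
theorem corankLE_mono {c c' : ℕ} (hcc' : c ≤ c') (h : PicoverLocalModelCorankLE c') :
    PicoverLocalModelCorankLE c := by
  intro p hp k _ _ R _ _ _ hft hreg a hgood
  exact h p hp k R hft hreg a (fun 𝔪 _ => goodLE_mono hcc' (hgood 𝔪))

/-- Dually, residuals shrink as the grade grows. [folklore] -/
theorem corankGT_mono {c c' : ℕ} (hcc' : c ≤ c') (h : PicoverLocalModelCorankGT c) :
    PicoverLocalModelCorankGT c' := by
  intro p hp k _ _ R _ _ _ hft hreg a hbad
  refine h p hp k R hft hreg a (fun hgood => hbad ?_)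
  intro 𝔪 _
  exact goodLE_mono hcc' (hgood 𝔪)

/-- EXACTNESS at every grade for the PARAMETRISED blocker shape: a radicand-wise conclusion holds for all radicands
iff it holds on the grade-`c` menu and on its complement (excluded middle on the pointwise class hypothesis); the
by-name instance for `PAlteration.PicoverLocalModel` is `PicoverLocalModelCorankLadder.picoverLocalModel_iff`.
[folklore] -/
theorem corank_split_iff (c : ℕ) :
    (∀ p : ℕ, p.Prime → ∀ (k : Type) [Field k] [CharP k p] (R : Type) [CommRing R] [IsDomain R]
      [Algebra k R], Algebra.FiniteType k R → IsRegularRing R → ∀ a : R, LocalModelRes p R a) ↔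
    PicoverLocalModelCorankLE c ∧ PicoverLocalModelCorankGT c := by
  constructor
  · intro h
    exact ⟨fun p hp k _ _ R _ _ _ hft hreg a _ => h p hp k R hft hreg a,
      fun p hp k _ _ R _ _ _ hft hreg a _ => h p hp k R hft hreg a⟩
  · rintro ⟨hle, hgt⟩ p hp k _ _ R _ _ _ hft hreg a
    by_cases hgood : AllGoodLE p c R a
    · exact hle p hp k R hft hreg a hgood
    · exact hgt p hp k R hft hreg a hgood

/-- The known grade rides along: grade `≤ 2` is a special case of grade `≤ 3`. [folklore] -/
theorem corankLE_two_of_three (h₃ : PicoverLocalModelCorankLE 3) : PicoverLocalModelCorankLE 2 :=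
  corankLE_mono (by norm_num) h₃

end Kernels

end Summit.ResolutionOfSingularities.ResolutionOfSingularities.Theorems.RadicandSplitCorank
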